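import Mathlib.Analysis.SpecialFunctions.Trigonometric.Deriv
import Literature.Claims.NS.Kyritsis2022
import Literature.Analysis.FluidPDE.VorticityStretching
import Literature.Analysis.FluidPDE.HolderEulerVolumePreserving
import HarnessLib

/-!
# NS-claims map, C03 (Kyritsis 2022): kernel checks of the typed proof skeleton
# `Literature.Claims.NS.Kyritsis2022`

Negations of steps of the typed skeleton, each by an explicit countermodel satisfying the typed
hypotheses of that step (print locators: K. E. Kyritsis, J. Appl. Math. Phys. 10 (2022)
2538–2560):

* `not_Step_6` — Lemma 4.2 in its printed generality (Lemma 4.2, eq. (4.3), p. 2550: «any finite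
  spherical volume (or more general shapes) … defined by flows-images of spherical volumes»;
  skeleton decl `Step_6`, the statement consumed by the composition `theorem44Finite_of_steps`
  at the flow preimage of a round ball, (4.15) p. 2555). Countermodel (static): the rigid
  rotation `w(y) = (−y₁/2, y₀/2, 0)` (smooth, divergence free, `curl w ≡ (0,0,1)`, so
  `sup |curl w| = 1`), the volume-preserving linear reference parametrisation
  `Φ = diag(2, 2, 1/4)`, `Ψ = Φ⁻¹ = diag(1/2, 1/2, 4)`, the unit axis `a = e₂`, the unit ball
  about `0`: the typed flux average `imageFluxAvg (curl w) Φ Ψ a 0 1` is the average of the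
  constant `⟪Ψ (0,0,1), e₂⟫ = 4` over the ball, i.e. `4 > 1`.
* `not_Step_10` — the passage (4.13)→(4.14) in the proof of Thm 4.4 (pp. 2554–2555), literal
  round-ball reading (skeleton decl `Step_10`, consumed by `theorem44Finite_of_steps_literal`).
  Countermodel (dynamic, within the printed periodic Euler scope): the `ℤ³`-periodic shear flow
  `u(t,x) = (sin 2πx₁, 0, sin 2π(x₀ − t sin 2πx₁))`, `p = 0`, with its explicit
  volume-preserving trajectory map; at the stagnation point `0`, axis `−e₀`, radius `1/16`,
  time `1/16`, the round-ball average is `0` at time `0` and `≥ π²/16` at time `1/16`.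
* `not_Theorem44Infinite`, `not_Step_11` — Thm 4.4's «infinite time» clause (pp. 2553–2555 and
  the abstract p. 2538; skeleton decls `Theorem44Infinite`, `Step_11 = Theorem44Finite ∧
  Theorem44Infinite`, the latter consumed by `claim_of_thm44`): the same shear flow is a global
  smooth periodic Euler solution with `sup|ω(0,·)| ≤ 4π` and `|ω(t,0)| ≥ 4π²t`.

Nothing here bears on Thm 4.4's finite-time clause for decaying or periodic viscous data.
Axioms: `propext`, `Classical.choice`, `Quot.sound` only (no `native_decide`).
WHAT THIS IS NOT: not a claim about NS regularity or blow-up; not a claim about any author beyond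
the typed locator.
SPLIT (gate lint «Theorems files with proofs ≤ 400 lines»; filed for the author ns-claims-refuter-1 by
ns-claims-salvage-p4, content unchanged): this file = linear toolkit + the static countermodel +
`not_Step_6`; `SoloRefuteKyritsis2022Shear.lean` = the periodic Euler shear flow (classical solution,
vorticity, periodicity); `SoloRefuteKyritsis2022Flow.lean` = its trajectory maps + `not_Theorem44Infinite`,
`not_Step_11`, `not_Step_10`.
-/

noncomputable section

open Real Set Function MeasureTheory InnerProductSpace
open Literature.Analysis.FluidPDE
open scoped ContDiff RealInnerProductSpace

-- The summit's canonical theorem namespace repeats the summit name (single-conjunct summit).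
set_option linter.dupNamespace false

namespace Summit.NavierStokesRegularity.NavierStokesRegularity.Theorems.Kyritsis2022

/-- Standard basis vector `eⱼ` of `ℝ³`. -/
def bv (j : Fin 3) : EuclideanSpace ℝ (Fin 3) := EuclideanSpace.single j 1

/-- Coordinates of `eⱼ`. -/
@[simp] theorem bv_apply (j i : Fin 3) : bv j i = if i = j then 1 else 0 := by
  simp [bv, PiLp.single_apply]

/-- `‖eⱼ‖ = 1`. -/
@[simp] theorem norm_bv (j : Fin 3) : ‖bv j‖ = 1 := by
  simp [bv]

/-- `⟪v, eⱼ⟫ = vⱼ`. -/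
@[simp] theorem inner_bv_right (v : EuclideanSpace ℝ (Fin 3)) (j : Fin 3) :
    ⟪v, bv j⟫ = v j := by
  simp [bv, EuclideanSpace.inner_single_right]

/-- Coordinate functional `y ↦ yⱼ`. -/
def pr (j : Fin 3) : EuclideanSpace ℝ (Fin 3) →L[ℝ] ℝ := EuclideanSpace.proj j

/-- `pr j y = yⱼ`. -/
@[simp] theorem pr_apply (j : Fin 3) (y : EuclideanSpace ℝ (Fin 3)) : pr j y = y j := rfl

/-- The linear map of `ℝ³` with matrix `M` (`M i j` = entry in row `i`, column `j`):
`(lin M y) i = M i 0 y₀ + M i 1 y₁ + M i 2 y₂`. -/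
def lin (M : Fin 3 → Fin 3 → ℝ) :
    EuclideanSpace ℝ (Fin 3) →L[ℝ] EuclideanSpace ℝ (Fin 3) :=
  (M 0 0 • pr 0 + M 0 1 • pr 1 + M 0 2 • pr 2).smulRight (bv 0) +
    (M 1 0 • pr 0 + M 1 1 • pr 1 + M 1 2 • pr 2).smulRight (bv 1) +
    (M 2 0 • pr 0 + M 2 1 • pr 1 + M 2 2 • pr 2).smulRight (bv 2)

/-- Components of `lin M y`. -/
@[simp] theorem lin_apply (M : Fin 3 → Fin 3 → ℝ) (y : EuclideanSpace ℝ (Fin 3))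
    (i : Fin 3) : lin M y i = M i 0 * y 0 + M i 1 * y 1 + M i 2 * y 2 := by
  fin_cases i <;> simp [lin]

/-- Matrix entries of `lin M`: `(lin M eⱼ)ᵢ = M i j`. -/
theorem lin_bv (M : Fin 3 → Fin 3 → ℝ) (j i : Fin 3) : lin M (bv j) i = M i j := by
  fin_cases j <;> fin_cases i <;> simp

/-- `det (lin M)` is the `3 × 3` determinant of the table `M`. -/
theorem det_lin (M : Fin 3 → Fin 3 → ℝ) :
    (lin M).det = M 0 0 * M 1 1 * M 2 2 - M 0 0 * M 1 2 * M 2 1 - M 0 1 * M 1 0 * M 2 2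
      + M 0 1 * M 1 2 * M 2 0 + M 0 2 * M 1 0 * M 2 1 - M 0 2 * M 1 1 * M 2 0 := by
  rw [det_eq_clmEntry_poly]
  simp only [clmEntry]
  have h : ∀ i j : Fin 3, (lin M) (EuclideanSpace.single j 1) i = M i j := fun i j => lin_bv M j i
  simp only [h]

/-- Divergence of a linear field: `div (lin M) = tr M`. -/
theorem divergence_lin (M : Fin 3 → Fin 3 → ℝ) (y : EuclideanSpace ℝ (Fin 3)) :
    VectorCalculus.divergence (fun z => lin M z) y = M 0 0 + M 1 1 + M 2 2 := by
  rw [VectorCalculus.divergence, (lin M).fderiv, trace_eq_sum_coord, Fin.sum_univ_three]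
  have h : ∀ i j : Fin 3, (lin M) (EuclideanSpace.single j 1) i = M i j := fun i j => lin_bv M j i
  rw [h, h, h]

/-- Vorticity of a linear field:
`curl (lin M) = (M₂₁ − M₁₂, M₀₂ − M₂₀, M₁₀ − M₀₁)`. -/
theorem curl_lin (M : Fin 3 → Fin 3 → ℝ) (y : EuclideanSpace ℝ (Fin 3)) :
    curl (fun z => lin M z) y = !₂[M 2 1 - M 1 2, M 0 2 - M 2 0, M 1 0 - M 0 1] := by
  rw [curl_eq_curlCLM, curlCLM_apply, (lin M).fderiv]
  have h : ∀ i j : Fin 3, (lin M) (EuclideanSpace.single j 1) i = M i j := fun i j => lin_bv M j i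
  simp only [h]

/-! ## The static countermodel to `Step_6` (Lemma 4.2 for general / flow-image shapes) -/

/-- Jacobian table of the rigid rotation `w(y) = (−y₁/2, y₀/2, 0)` about the `e₂`-axis. -/
def rotM : Fin 3 → Fin 3 → ℝ := ![![0, -(1 / 2 : ℝ), 0], ![(1 / 2 : ℝ), 0, 0], ![0, 0, 0]]

/-- The rigid rotation `w(y) = (−y₁/2, y₀/2, 0)`. -/
def rot (y : EuclideanSpace ℝ (Fin 3)) : EuclideanSpace ℝ (Fin 3) := lin rotM y

/-- `rot` is smooth (it is linear). -/
theorem contDiff_rot : ContDiff ℝ ∞ rot := (lin rotM).contDiff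

/-- `rot` is divergence free. -/
theorem isDivFree_rot : VectorCalculus.IsDivFree rot := fun y => by
  change VectorCalculus.divergence (fun z => lin rotM z) y = 0
  rw [divergence_lin]
  simp [rotM]

/-- `curl rot ≡ (0, 0, 1)`. -/
theorem curl_rot (y : EuclideanSpace ℝ (Fin 3)) : curl rot y = bv 2 := by
  rw [show rot = fun z => lin rotM z from rfl, curl_lin]
  ext i
  fin_cases i <;> simp [rotM]
  norm_num

/-- `|curl rot| ≡ 1`. -/
theorem norm_curl_rot (y : EuclideanSpace ℝ (Fin 3)) : ‖curl rot y‖ = 1 := by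
  rw [curl_rot, norm_bv]

/-- The vorticity of `rot` is bounded (the typed hypothesis `F_ω < ∞`). -/
theorem bddAbove_norm_curl_rot : BddAbove (Set.range fun y => ‖curl rot y‖) :=
  ⟨1, by rintro _ ⟨y, rfl⟩; exact (norm_curl_rot y).le⟩

/-- `sup |curl rot| = 1`. -/
theorem iSup_norm_curl_rot : (⨆ y, ‖curl rot y‖) = 1 := by
  simp_rw [norm_curl_rot]
  exact ciSup_const

/-- Table of the volume-preserving stretching `Φ = diag(2, 2, 1/4)`. -/
def phiM : Fin 3 → Fin 3 → ℝ := ![![2, 0, 0], ![0, 2, 0], ![0, 0, (1 / 4 : ℝ)]]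

/-- Table of its inverse `Ψ = diag(1/2, 1/2, 4)`. -/
def psiM : Fin 3 → Fin 3 → ℝ := ![![(1 / 2 : ℝ), 0, 0], ![0, (1 / 2 : ℝ), 0], ![0, 0, 4]]

/-- The volume-preserving stretching `Φ = diag(2, 2, 1/4)`. -/
def phiD (y : EuclideanSpace ℝ (Fin 3)) : EuclideanSpace ℝ (Fin 3) := lin phiM y

/-- Its inverse `Ψ = diag(1/2, 1/2, 4)`. -/
def psiD (y : EuclideanSpace ℝ (Fin 3)) : EuclideanSpace ℝ (Fin 3) := lin psiM y

/-- `Φ` is smooth. -/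
theorem contDiff_phiD : ContDiff ℝ ∞ phiD := (lin phiM).contDiff

/-- `Ψ` is smooth. -/
theorem contDiff_psiD : ContDiff ℝ ∞ psiD := (lin psiM).contDiff

/-- `Ψ ∘ Φ = id`. -/
theorem psiD_phiD (y : EuclideanSpace ℝ (Fin 3)) : psiD (phiD y) = y := by
  ext i
  fin_cases i <;> simp [phiD, psiD, phiM, psiM]

/-- `Φ ∘ Ψ = id`. -/
theorem phiD_psiD (y : EuclideanSpace ℝ (Fin 3)) : phiD (psiD y) = y := by
  ext i
  fin_cases i <;> simp [phiD, psiD, phiM, psiM]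

/-- The derivative of `Φ` is `diag(2,2,1/4)` at every point. -/
theorem fderiv_phiD (y : EuclideanSpace ℝ (Fin 3)) : fderiv ℝ phiD y = lin phiM :=
  (lin phiM).fderiv

/-- The derivative of `Ψ` is `diag(1/2,1/2,4)` at every point. -/
theorem fderiv_psiD (y : EuclideanSpace ℝ (Fin 3)) : fderiv ℝ psiD y = lin psiM :=
  (lin psiM).fderiv

/-- `Φ` is volume preserving: `det DΦ = 2·2·(1/4) = 1`. -/
theorem det_fderiv_phiD (y : EuclideanSpace ℝ (Fin 3)) : (fderiv ℝ phiD y).det = 1 := by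
  rw [fderiv_phiD, det_lin]
  simp [phiM]
  norm_num

/-- `Ψ` is volume preserving: `det DΨ = (1/2)(1/2)4 = 1`. -/
theorem det_fderiv_psiD (y : EuclideanSpace ℝ (Fin 3)) : (fderiv ℝ psiD y).det = 1 := by
  rw [fderiv_psiD, det_lin]
  simp [psiM]
  norm_num

/-- The typed flux average of `curl rot` over the `Φ`-image of the unit ball, axis `e₂`, is `4`:
the integrand `⟪DΨ(Φy) (curl rot)(Φy), e₂⟫ = ⟪(0,0,4), e₂⟫` is the constant `4`. -/
theorem imageFluxAvg_rot :
    Literature.Claims.NS.Kyritsis2022.imageFluxAvg (curl rot) phiD psiD (bv 2) 0 1 = 4 := by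
  unfold Literature.Claims.NS.Kyritsis2022.imageFluxAvg
  have hconst : ∀ y : EuclideanSpace ℝ (Fin 3),
      ⟪(fderiv ℝ psiD (phiD y)) (curl rot (phiD y)), bv 2⟫ = (4 : ℝ) := by
    intro y
    rw [fderiv_psiD, curl_rot, inner_bv_right, lin_apply]
    simp [psiM]
  simp_rw [hconst]
  exact setAverage_const
    (Metric.measure_ball_pos volume (0 : EuclideanSpace ℝ (Fin 3)) one_pos).ne'
    measure_ball_lt_top.ne (4 : ℝ)

/-- **`Step_6` of the typed skeleton is false.** Locator: Kyritsis 2022, Lemma 4.2, eq. (4.3),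
print p. 2550 («any finite spherical volume (or more general shapes)»), skeleton decl
`Literature.Claims.NS.Kyritsis2022.Step_6` (consumed by `theorem44Finite_of_steps`).
Countermodel, in words: a rigid rotation has constant vorticity `(0,0,1)` (sup norm `1`); for the
volume-preserving stretched reference shape `Φ = diag(2,2,1/4)` (inverse `Ψ = diag(1/2,1/2,4)`,
both smooth with Jacobian determinant `1`) and the unit axis `e₂`, the typed pulled-back flux
average over the unit ball is the constant `⟪Ψ(0,0,1), e₂⟫ = 4 > 1`. Axioms: propext,
Classical.choice, Quot.sound. -/
theorem not_Step_6 : ¬ Literature.Claims.NS.Kyritsis2022.Step_6 := by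
  intro h
  have hle := h rot contDiff_rot isDivFree_rot bddAbove_norm_curl_rot phiD psiD contDiff_phiD
    contDiff_psiD psiD_phiD phiD_psiD det_fderiv_phiD det_fderiv_psiD (bv 2) (norm_bv 2) 0 1
    one_pos
  rw [imageFluxAvg_rot, iSup_norm_curl_rot] at hle
  norm_num at hle

end Summit.NavierStokesRegularity.NavierStokesRegularity.Theorems.Kyritsis2022

end
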